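import Summits.CriticalPhenomena.SAWScalingLimit.Theorems.SAWDefectDecoherenceBoundaryClosureRBoundaryDataTransferFloorValue
import HarnessLib

/-!
# Boundary data transfer, IV: the divergence at the root in the limit

Route `SAWDefectDecoherence`, crux `BoundaryClosureR` (stmt-CriticalPhenomena-14004), line
`pick-half-plane`, stub `stub_engineBoundaryData` (r13): hypothesis (I3) of the landed
`pickEngine_stage2` for every engine limit `h` — `h` is unbounded at the root from inside the
carrier:

* `divergence_at` — at one scale of the root frame: the east-arm arrival mass beyond `re x + η`
  (`FlatMassLaws` (b), a window `∑ᶠ` identified with a column sum by `finsum_boundaryWindow_eq`)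
  is an exact difference of the developing map along the floor (`east_cols_norm`), so a large mass
  forces a large floor-site value under `x + η` and forces `η` below any prescribed `κ₁`;
* `divergence` — in the limit (`floorSite_value` at `x + η`, `x + κ₁`, `x + 9r/16`; continuity of
  `h` on `U` at `x + η` produces carrier points with `‖h‖ ≥ A` in every ball about `x`);
* `sum_Ico_split` / `boundaryDataTransfer_sumIcoSplit` (registered).
-/

noncomputable section

open scoped Topology
open Filter Set
open Complex (I exp)
open Literature.Probability.LatticeModels Literature.Probability.RandomPlanarGeometry
open Literature.Probability.RandomPlanarGeometry.SAW
open Summit.CriticalPhenomena.SAWScalingLimit.Theorems.PickHalfPlane.RootWedge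
open Summit.CriticalPhenomena.SAWScalingLimit.Theorems.PickHalfPlane.DevelopingMaps
open Summit.CriticalPhenomena.SAWScalingLimit.Theorems.PickHalfPlane.BoundaryExactness

namespace Summit.CriticalPhenomena.SAWScalingLimit.Theorems.PickHalfPlane.BoundaryDataTransfer

/-! ### One scale -/

/-- Splitting a column sum at an intermediate column. [folklore] -/
theorem sum_Ico_split {f : ℤ → ℝ} {a c : ℤ} (b : ℤ) (hab : a ≤ b) (hbc : b ≤ c) :
    ∑ k ∈ Finset.Ico a c, f k = ∑ k ∈ Finset.Ico a b, f k + ∑ k ∈ Finset.Ico b c, f k := by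
  rw [← Finset.Ico_union_Ico_eq_Ico hab hbc, Finset.sum_union (Finset.Ico_disjoint_Ico_consecutive a b c)]

/-- **Registered helper `boundaryDataTransfer_sumIcoSplit`** (crux stmt-CriticalPhenomena-14004, line
`pick-half-plane`, stub `stub_engineBoundaryData`): splitting an integer column sum, ∀-closed
(`sum_Ico_split`). [folklore] -/
theorem boundaryDataTransfer_sumIcoSplit : ∀ (f : ℤ → ℝ) (a b c : ℤ), a ≤ b → b ≤ c → ∑ k ∈ Finset.Ico a c, f k = ∑ k ∈ Finset.Ico a b, f k + ∑ k ∈ Finset.Ico b c, f k :=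
  fun _ _ b _ hab hbc => sum_Ico_split b hab hbc

/-- **The divergence at one scale.**  At a scale of the root frame (root `floorEdge ka M` within
`ε_f` of `x`, normaliser `floorEdge kb mb`, flat window of half-width `3r/4`, root pin): if the
east-arm mass beyond `re x + η` inside `ball x (r/2)` is at least `A'·Z_b/δ` (the body of
`FlatMassLaws` (b)) and the floor-site values under `y = x + η`, `z₁ = x + κ₁`, `z₂ = x + 9r/16`
are within `1` of `h y`, `h z₁`, `h z₂`, then `(√3/6)A' ≤ 2‖h z₁‖ + ‖h z₂‖ + 4 + ‖h y‖`, and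
`η < κ₁ + δ` as soon as `‖h z₁‖ + ‖h z₂‖ + 2 < (√3/6)A'` (exact east-arm sums `east_cols_norm`,
window identification `finsum_boundaryWindow_eq`). [cite: DuminilCopinSmirnov2012, §4 (the map H with dH = F dz)] -/
theorem divergence_at {Λ : Finset HexVertex} (hΛ : hexDomainSimplyConnected Λ) {δ r η κ₁ εf A' : ℝ}
    {x y z₁ z₂ : ℂ} {M ka kb mb : ℤ} {ee bb : Sym2 HexVertex} (hδ0 : 0 < δ) (hδr : δ < r / 16)
    (hη0 : 0 < η) (hη : η < r / 2) (hκ₁0 : 0 < κ₁) (hκ₁ : κ₁ ≤ r / 4) (hεfη : εf + δ < η) (hεfκ : εf + δ < κ₁)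
    (hεf : εf ≤ r / 8)
    (he : ee = floorEdge ka M) (hb : bb = floorEdge kb mb) (hUb : upFace kb mb ∈ Λ) (hBb : belowFace kb mb ∉ Λ)
    (hneb : floorEdge kb mb ≠ floorEdge ka M) (γb : HexMidEdgeSAW Λ (floorEdge ka M) (floorEdge kb mb))
    (hnear : ‖(δ : ℂ) * hexMidpoint ee - x‖ < εf)
    (hW : ∀ k : ℤ, |δ * (k + M / 2) - x.re| ≤ 3 * r / 4 →
      upFace k M ∈ Λ ∧ belowFace k M ∉ Λ ∧ ((![k, M], 1) : HexVertex) ∈ Λ ∧ ((![k - 1, M], 1) : HexVertex) ∈ Λ)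
    (hpin : ∀ v : HexVertex, (δ : ℂ) * hexCenter v ∈ Metric.ball x r → (v ∈ Λ ↔ M ≤ v.1 1))
    {H : Site 2 → ℂ} (hH : IsPotential Λ ee H) {sb : Site 2} {h : ℂ → ℂ}
    (hy : y.re = x.re + η) (hz₁ : z₁.re = x.re + κ₁) (hz₂ : z₂.re = x.re + 9 * r / 16)
    (hmass : A' * ‖hexParafermionicObservable Λ ee hexCriticalFugacity 0 bb‖ ≤
      δ * ∑ᶠ e' ∈ {e' : Sym2 HexVertex | e' ∈ hexDomainBoundary Λ ∧
          (δ : ℂ) * hexMidpoint e' ∈ Metric.ball x (r / 2) ∧ x.re + η < ((δ : ℂ) * hexMidpoint e').re},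
        ‖hexParafermionicObservable Λ ee hexCriticalFugacity 0 e'‖)
    (hvy : ‖(δ : ℂ) * (H ![⌊y.re / δ - M / 2⌋, M] - H sb) /
      hexParafermionicObservable Λ ee hexCriticalFugacity (5 / 8) bb - h y‖ ≤ 1)
    (hv₁ : ‖(δ : ℂ) * (H ![⌊z₁.re / δ - M / 2⌋, M] - H sb) /
      hexParafermionicObservable Λ ee hexCriticalFugacity (5 / 8) bb - h z₁‖ ≤ 1)
    (hv₂ : ‖(δ : ℂ) * (H ![⌊z₂.re / δ - M / 2⌋, M] - H sb) /
      hexParafermionicObservable Λ ee hexCriticalFugacity (5 / 8) bb - h z₂‖ ≤ 1) :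
    Real.sqrt 3 / 6 * A' ≤ 2 * ‖h z₁‖ + ‖h z₂‖ + 4 + ‖h y‖ ∧
    (‖h z₁‖ + ‖h z₂‖ + 2 < Real.sqrt 3 / 6 * A' → η < κ₁ + δ) := by
  -- the columns
  set ay : ℤ := ⌊y.re / δ - M / 2⌋ with hay
  set a₁ : ℤ := ⌊z₁.re / δ - M / 2⌋ with ha₁
  set a : ℤ := ⌊z₂.re / δ - M / 2⌋ with ha
  have hzx₁ : |z₁.re - x.re| < r / 2 := by rw [hz₁, abs_lt]; constructor <;> linarith
  have hyx : |y.re - x.re| < r / 2 := by rw [hy, abs_lt]; constructor <;> linarith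
  obtain ⟨⟨hka₁, hka₂⟩, -, hka_ay, -⟩ := rootColumns hδ0 (by linarith) he hnear hεf hyx
  obtain ⟨-, -, hka_a₁, -⟩ := rootColumns hδ0 (by linarith) he hnear hεf hzx₁
  replace hka_ay : ka < ay := hka_ay (by rw [hy]; linarith)
  replace hka_a₁ : ka < a₁ := hka_a₁ (by rw [hz₁]; linarith)
  have hcy := floorColumn_near hδ0 y.re M
  have hc₁ := floorColumn_near hδ0 z₁.re M
  have hca := floorColumn_near hδ0 z₂.re M
  rw [← hay] at hcy; rw [← ha₁] at hc₁; rw [← ha] at hca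
  rw [hy] at hcy; rw [hz₁] at hc₁; rw [hz₂] at hca
  have hlt : ∀ {i i' : ℤ}, δ * (i + M / 2) < δ * (i' + M / 2) → i < i' := fun {i i'} hlt => by
    have h1 : δ * i < δ * i' := by linarith
    have : (i : ℝ) < i' := lt_of_mul_lt_mul_left h1 hδ0.le
    exact_mod_cast this
  have hle' : ∀ {i i' : ℤ}, δ * (i + M / 2) < δ * (i' + M / 2) + δ → i ≤ i' := fun {i i'} hlt => by
    have h1 : δ * i < δ * (i' + 1) := by linarith
    have : (i : ℝ) < i' + 1 := lt_of_mul_lt_mul_left h1 hδ0.le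
    have : i < i' + 1 := by exact_mod_cast this
    omega
  have hay_a : ay < a := hlt (by linarith)
  have ha₁_a : a₁ < a := hlt (by linarith)
  have ha_k₂ : a ≤ ⌊(x.re + 3 * r / 4) / δ - M / 2⌋ :=
    (mem_Icc_window hδ0 (show |δ * (a + M / 2) - x.re| < 3 * r / 4 by
      rw [abs_lt]; constructor <;> linarith)).2
  have hF := flat_of_window hδ0 hW
  have hH' : IsPotential Λ (floorEdge ka M) H := by rw [← he]; exact hH
  set Z : Sym2 HexVertex → ℝ := fun e' => ‖hexParafermionicObservable Λ (floorEdge ka M) hexCriticalFugacity 0 e'‖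
    with hZ
  set Fb := hexParafermionicObservable Λ (floorEdge ka M) hexCriticalFugacity (5 / 8) (floorEdge kb mb) with hFb
  have hZb := (normaliser_observable hΛ (hF ka hka₁ hka₂).1 (hF ka hka₁ hka₂).2.1 hUb hBb hneb γb).2
  rw [he, hb] at hmass hvy hv₁ hv₂
  -- the window sum is dominated by the column sum over `[ay, a)`
  set S : Set ℂ := {w : ℂ | w ∈ Metric.ball x (r / 2) ∧ x.re + η < w.re} with hS
  have hSr : ∀ w ∈ S, dist w x + δ / 2 < r := fun w hw => by
    have := Metric.mem_ball.1 hw.1; linarith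
  have hwin : ∑ᶠ e' ∈ {e' : Sym2 HexVertex | e' ∈ hexDomainBoundary Λ ∧
      (δ : ℂ) * hexMidpoint e' ∈ Metric.ball x (r / 2) ∧ x.re + η < ((δ : ℂ) * hexMidpoint e').re}, Z e' ≤
      ∑ k ∈ Finset.Ico ay a, Z (floorEdge k M) := by
    have hset : {e' : Sym2 HexVertex | e' ∈ hexDomainBoundary Λ ∧
        (δ : ℂ) * hexMidpoint e' ∈ Metric.ball x (r / 2) ∧ x.re + η < ((δ : ℂ) * hexMidpoint e').re} =
        {e' : Sym2 HexVertex | e' ∈ hexDomainBoundary Λ ∧ (δ : ℂ) * hexMidpoint e' ∈ S} := rfl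
    rw [hset, GateMass.finsum_boundaryWindow_eq hδ0.le hpin hSr]
    refine finsum_window_le_sum_Ico (fun _ => norm_nonneg _) fun k hk => ?_
    obtain ⟨hkb, hkη⟩ := hk
    rw [re_scaled_hexMidpoint_floorEdge] at hkη
    have hkre : δ * (k + M / 2) + δ / 2 - x.re < r / 2 := by
      have h1 := Complex.abs_re_le_norm ((δ : ℂ) * hexMidpoint (floorEdge k M) - x)
      rw [Complex.sub_re, re_scaled_hexMidpoint_floorEdge] at h1
      rw [Metric.mem_ball, dist_eq_norm] at hkb
      exact lt_of_le_of_lt (le_abs_self _) (lt_of_le_of_lt h1 hkb)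
    exact ⟨hle' (by linarith), hlt (by linarith)⟩
  -- column sums as differences of the developing map
  have hnorm : ∀ {a' a'' : ℤ}, ka < a' → a' ≤ a'' → a'' ≤ a →
      δ * (Real.sqrt 3 / 6 * (∑ k ∈ Finset.Ico a' a'', Z (floorEdge k M)) /
        ‖hexParafermionicObservable Λ (floorEdge ka M) hexCriticalFugacity 0 (floorEdge kb mb)‖) =
      ‖(δ : ℂ) * (H ![a'', M] - H sb) / Fb - (δ : ℂ) * (H ![a', M] - H sb) / Fb‖ := by
    intro a' a'' h1 h2 h3
    rw [← east_cols_norm hΛ hF hka₁ hka₂ hUb hBb hneb γb hH' h1 h2 (by omega), ← hFb,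
      show (δ : ℂ) * (H ![a'', M] - H sb) / Fb - (δ : ℂ) * (H ![a', M] - H sb) / Fb =
        (δ : ℂ) * ((H ![a'', M] - H ![a', M]) / Fb) by ring, norm_mul, Complex.norm_real,
      Real.norm_of_nonneg hδ0.le]
  -- the total over `[ay, a)` dominates `A'`
  have hmain : Real.sqrt 3 / 6 * A' ≤ δ * (Real.sqrt 3 / 6 * (∑ k ∈ Finset.Ico ay a, Z (floorEdge k M)) /
      ‖hexParafermionicObservable Λ (floorEdge ka M) hexCriticalFugacity 0 (floorEdge kb mb)‖) := by
    rw [mul_div_assoc', le_div_iff₀ hZb]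
    have := mul_le_mul_of_nonneg_left (hmass.trans (mul_le_mul_of_nonneg_left hwin hδ0.le))
      (show (0 : ℝ) ≤ Real.sqrt 3 / 6 by positivity)
    linarith
  have hv₁n : ‖(δ : ℂ) * (H ![a₁, M] - H sb) / Fb‖ ≤ ‖h z₁‖ + 1 := by
    have := norm_sub_norm_le ((δ : ℂ) * (H ![a₁, M] - H sb) / Fb) (h z₁); linarith
  -- the tail `[a₁, a)` is bounded by the values at `z₁`, `z₂`
  have htail : δ * (Real.sqrt 3 / 6 * (∑ k ∈ Finset.Ico a₁ a, Z (floorEdge k M)) /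
      ‖hexParafermionicObservable Λ (floorEdge ka M) hexCriticalFugacity 0 (floorEdge kb mb)‖) ≤
      ‖h z₁‖ + ‖h z₂‖ + 2 := by
    rw [hnorm hka_a₁ ha₁_a.le le_rfl]
    have h2 : ‖(δ : ℂ) * (H ![a, M] - H sb) / Fb‖ ≤ ‖h z₂‖ + 1 := by
      have := norm_sub_norm_le ((δ : ℂ) * (H ![a, M] - H sb) / Fb) (h z₂); linarith
    calc ‖(δ : ℂ) * (H ![a, M] - H sb) / Fb - (δ : ℂ) * (H ![a₁, M] - H sb) / Fb‖
        ≤ ‖(δ : ℂ) * (H ![a, M] - H sb) / Fb‖ + ‖(δ : ℂ) * (H ![a₁, M] - H sb) / Fb‖ := norm_sub_le _ _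
      _ ≤ ‖h z₁‖ + ‖h z₂‖ + 2 := by linarith
  have hnn : ∀ i ∈ Finset.Ico a₁ a, i ∉ Finset.Ico ay a → 0 ≤ Z (floorEdge i M) := fun _ _ _ => norm_nonneg _
  by_cases hcase : ay ≤ a₁
  · have hsplit := sum_Ico_split (f := fun k => Z (floorEdge k M)) a₁ hcase ha₁_a.le
    have hhead : δ * (Real.sqrt 3 / 6 * (∑ k ∈ Finset.Ico ay a₁, Z (floorEdge k M)) /
        ‖hexParafermionicObservable Λ (floorEdge ka M) hexCriticalFugacity 0 (floorEdge kb mb)‖) ≤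
        ‖h z₁‖ + 1 + ‖h y‖ + 1 := by
      rw [hnorm hka_ay hcase ha₁_a.le]
      have h2 : ‖(δ : ℂ) * (H ![ay, M] - H sb) / Fb‖ ≤ ‖h y‖ + 1 := by
        have := norm_sub_norm_le ((δ : ℂ) * (H ![ay, M] - H sb) / Fb) (h y); linarith
      calc ‖(δ : ℂ) * (H ![a₁, M] - H sb) / Fb - (δ : ℂ) * (H ![ay, M] - H sb) / Fb‖
          ≤ ‖(δ : ℂ) * (H ![a₁, M] - H sb) / Fb‖ + ‖(δ : ℂ) * (H ![ay, M] - H sb) / Fb‖ := norm_sub_le _ _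
        _ ≤ ‖h z₁‖ + 1 + ‖h y‖ + 1 := by linarith
    have htot : δ * (Real.sqrt 3 / 6 * (∑ k ∈ Finset.Ico ay a, Z (floorEdge k M)) /
        ‖hexParafermionicObservable Λ (floorEdge ka M) hexCriticalFugacity 0 (floorEdge kb mb)‖) ≤
        2 * ‖h z₁‖ + ‖h z₂‖ + 4 + ‖h y‖ := by
      rw [hsplit, mul_add, add_div, mul_add]; linarith
    refine ⟨hmain.trans htot, fun _ => ?_⟩
    have hc : (ay : ℝ) ≤ a₁ := by exact_mod_cast hcase
    have : δ * (ay + M / 2) ≤ δ * (a₁ + M / 2) := mul_le_mul_of_nonneg_left (by linarith) hδ0.le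
    linarith [hcy.1, hc₁.2]
  · have hsub : Finset.Ico ay a ⊆ Finset.Ico a₁ a := Finset.Ico_subset_Ico (not_le.1 hcase).le le_rfl
    have hle : δ * (Real.sqrt 3 / 6 * (∑ k ∈ Finset.Ico ay a, Z (floorEdge k M)) /
        ‖hexParafermionicObservable Λ (floorEdge ka M) hexCriticalFugacity 0 (floorEdge kb mb)‖) ≤
        ‖h z₁‖ + ‖h z₂‖ + 2 := by
      refine le_trans ?_ htail
      have := Finset.sum_le_sum_of_subset_of_nonneg hsub hnn
      have h6 : (0 : ℝ) ≤ Real.sqrt 3 / 6 := by positivity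
      apply mul_le_mul_of_nonneg_left _ hδ0.le
      exact div_le_div_of_nonneg_right (mul_le_mul_of_nonneg_left this h6) hZb.le
    refine ⟨hmain.trans (hle.trans (by linarith [norm_nonneg (h z₁), norm_nonneg (h y)])), fun hbig => ?_⟩
    linarith


section Frame

/-! ### In the limit -/

variable {D : DobrushinDomain} {ρ : ℝ} {Λ : ℝ → Finset HexVertex} {m : ℝ → ℤ} {b : ℝ → Sym2 HexVertex}
  (hAF : 0 < ρ ∧
    D.carrier ∩ Metric.ball (D.pt 1) ρ = {z : ℂ | (D.pt 1).im < z.im} ∩ Metric.ball (D.pt 1) ρ ∧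
    (∀ᶠ δ : ℝ in 𝓝[>] 0, hexDomainSimplyConnected (Λ δ) ∧ b δ ∈ hexDomainBoundary (Λ δ) ∧
      (hexGraph.induce ((Λ δ : Finset HexVertex) : Set HexVertex)).Preconnected ∧
      (∀ v ∈ Λ δ, (δ : ℂ) * hexCenter v ∈ D.carrier) ∧
      (∀ v : HexVertex, (δ : ℂ) * hexCenter v ∈ Metric.ball (D.pt 1) ρ →
        (v ∈ Λ δ ↔ m δ ≤ v.1 1))) ∧
    (∀ K : Set ℂ, IsCompact K → K ⊆ D.carrier →
      ∀ᶠ δ : ℝ in 𝓝[>] 0, ∀ v : HexVertex, (δ : ℂ) * hexCenter v ∈ K → v ∈ Λ δ) ∧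
    Tendsto (fun δ : ℝ => (δ : ℂ) * hexMidpoint (b δ)) (𝓝[>] 0) (𝓝 (D.pt 1)))
  {x : ℂ} {e : ℝ → Sym2 HexVertex} {r : ℝ} {mr : ℝ → ℤ}
  (hPR : 0 < r ∧ D.carrier ∩ Metric.ball x r = {z : ℂ | x.im < z.im} ∩ Metric.ball x r ∧
    (∀ᶠ δ : ℝ in 𝓝[>] 0, e δ ∈ hexDomainBoundary (Λ δ) ∧
      Nonempty (HexMidEdgeSAW (Λ δ) (e δ) (b δ)) ∧
      (∀ v : HexVertex, (δ : ℂ) * hexCenter v ∈ Metric.ball x r → (v ∈ Λ δ ↔ mr δ ≤ v.1 1))) ∧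
    Tendsto (fun δ : ℝ => (δ : ℂ) * hexMidpoint (e δ)) (𝓝[>] 0) (𝓝 x))
  (hx : x ≠ D.pt 1)
  (hSup : ∀ K : Set ℂ, IsCompact K →
    K ⊆ D.carrier ∪ (({z : ℂ | z.im = (D.pt 1).im} ∩ Metric.ball (D.pt 1) ρ) ∪
      ({z : ℂ | z.im = x.im} ∩ Metric.ball x r)) → x ∉ K →
    ∃ C : ℝ, ∀ᶠ δ : ℝ in 𝓝[>] 0, ∀ z ∈ hexDomainMidEdges (Λ δ), (δ : ℂ) * hexMidpoint z ∈ K →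
      ‖hexParafermionicObservable (Λ δ) (e δ) hexCriticalFugacity (5 / 8) z‖ ≤
        C * ‖hexParafermionicObservable (Λ δ) (e δ) hexCriticalFugacity (5 / 8) (b δ)‖)
  {ns : ℕ → ℝ} (hns : Tendsto ns atTop (𝓝[>] 0)) {h : ℂ → ℂ}
  (hcont : ContinuousOn h ((D.carrier ∪ (({z : ℂ | z.im = (D.pt 1).im} ∩ Metric.ball (D.pt 1) ρ) ∪
    ({z : ℂ | z.im = x.im} ∩ Metric.ball x r))) \ {x}))
  (hconv : ∀ K : Set ℂ, IsCompact K →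
    K ⊆ (D.carrier ∪ (({z : ℂ | z.im = (D.pt 1).im} ∩ Metric.ball (D.pt 1) ρ) ∪
      ({z : ℂ | z.im = x.im} ∩ Metric.ball x r))) \ {x} →
    ∀ ε : ℝ, 0 < ε → ∀ᶠ n : ℕ in atTop, ∀ H : Site 2 → ℂ, IsPotential (Λ (ns n)) (e (ns n)) H →
      ∀ (ub wb : HexVertex), b (ns n) = s(ub, wb) →
      ∀ sb : Site 2, sb ∈ hexFaceVertices ub → sb ∈ hexFaceVertices wb →
      ∀ s : Site 2, IsLatticeSite (Λ (ns n)) s → ((ns n : ℝ) : ℂ) * triEmbed s ∈ K →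
        ‖((ns n : ℝ) : ℂ) * (H s - H sb) /
              hexParafermionicObservable (Λ (ns n)) (e (ns n)) hexCriticalFugacity (5 / 8) (b (ns n)) -
            h (((ns n : ℝ) : ℂ) * triEmbed s)‖ < ε)

include hAF hPR hx hSup hns hcont hconv

/-- **(I3) of `pickEngine_stage2` for an engine limit**: `h` is unbounded at the root from inside the
carrier, given the east-arm divergence of the arrival masses (the body of `FlatMassLaws` (b) at
these data).  For `A` and a radius `κ`: with `z₁ = x + κ₁`, `z₂ = x + 9r/16` and
`A' = 2√3(|A| + 2‖h z₁‖ + ‖h z₂‖ + 6)`, the law gives `η`; at a good scale `divergence_at` bounds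
`‖h(x + η)‖ ≥ |A| + 2` and forces `η < κ`; continuity of `h` on `U` at `x + η` gives a carrier
point above it with `‖h‖ ≥ A`. [cite: DuminilCopinSmirnov2012, §4 (the map H with dH = F dz)] -/
theorem divergence
    (hArm : ∀ A : ℝ, ∃ η : ℝ, 0 < η ∧ η < r / 2 ∧ ∀ᶠ δ : ℝ in 𝓝[>] 0,
      A * ‖hexParafermionicObservable (Λ δ) (e δ) hexCriticalFugacity 0 (b δ)‖ ≤
        δ * ∑ᶠ e' ∈ {e' : Sym2 HexVertex | e' ∈ hexDomainBoundary (Λ δ) ∧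
          (δ : ℂ) * hexMidpoint e' ∈ Metric.ball x (r / 2) ∧ x.re + η < ((δ : ℂ) * hexMidpoint e').re},
          ‖hexParafermionicObservable (Λ δ) (e δ) hexCriticalFugacity 0 e'‖)
    (A : ℝ) : ∃ᶠ z in 𝓝[D.carrier] x, A ≤ ‖h z‖ := by
  obtain ⟨hr, hcarx, hevx, helim⟩ := hPR
  rw [(Metric.nhdsWithin_basis_ball (x := x) (s := D.carrier)).frequently_iff]
  intro κ hκ
  have hpin := hevx.mono fun _ h => h.2.2
  have hbd := hevx.mono fun _ h => h.1
  -- flat points of the root piece east of `x`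
  have hflat : ∀ {u : ℝ}, 0 < u → u < r → (x + (u : ℂ)).im = x.im ∧ (x + (u : ℂ)).re = x.re + u ∧
      ‖x + (u : ℂ) - x‖ < r ∧
      x + (u : ℂ) ∈ (D.carrier ∪ (({z : ℂ | z.im = (D.pt 1).im} ∩ Metric.ball (D.pt 1) ρ) ∪
        ({z : ℂ | z.im = x.im} ∩ Metric.ball x r))) \ {x} := by
    intro u hu hur
    have hn : ‖x + (u : ℂ) - x‖ < r := by rw [add_sub_cancel_left, Complex.norm_real, Real.norm_of_nonneg hu.le]; exact hur
    refine ⟨by simp, by simp, hn, Or.inr (Or.inr ⟨by simp, by rwa [Metric.mem_ball, dist_eq_norm]⟩), fun h0 => ?_⟩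
    have : (x + (u : ℂ)).re = x.re := by rw [show x + (u : ℂ) = x from h0]
    simp at this; exact hu.ne' this
  set κ₁ : ℝ := min κ (r / 4) / 2 with hκ₁
  have hminκ : 0 < min κ (r / 4) := lt_min hκ (by linarith)
  have hκ₁0 : 0 < κ₁ := by positivity
  have hκ₁κ : 2 * κ₁ ≤ κ := by have := min_le_left κ (r / 4); rw [hκ₁]; linarith
  have hκ₁r : κ₁ ≤ r / 8 := by have := min_le_right κ (r / 4); rw [hκ₁]; linarith
  obtain ⟨hz₁im, hz₁re, hz₁r, hz₁U⟩ := hflat hκ₁0 (by linarith)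
  obtain ⟨hz₂im, hz₂re, hz₂r, hz₂U⟩ := hflat (u := 9 * r / 16) (by positivity) (by linarith)
  set z₁ : ℂ := x + (κ₁ : ℂ) with hz₁
  set z₂ : ℂ := x + ((9 * r / 16 : ℝ) : ℂ) with hz₂
  set A' : ℝ := 2 * Real.sqrt 3 * (|A| + 2 * ‖h z₁‖ + ‖h z₂‖ + 6) with hA'
  have hA'val : Real.sqrt 3 / 6 * A' = |A| + 2 * ‖h z₁‖ + ‖h z₂‖ + 6 := by
    rw [hA', show Real.sqrt 3 / 6 * (2 * Real.sqrt 3 * (|A| + 2 * ‖h z₁‖ + ‖h z₂‖ + 6)) =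
      (Real.sqrt 3 * Real.sqrt 3) / 3 * (|A| + 2 * ‖h z₁‖ + ‖h z₂‖ + 6) by ring,
      Real.mul_self_sqrt (by norm_num : (0 : ℝ) ≤ 3)]
    ring
  obtain ⟨η, hη0, hηr, hmass⟩ := hArm A'
  obtain ⟨hyim, hyre, hyr, hyU⟩ := hflat hη0 (by linarith)
  set y : ℂ := x + (η : ℂ) with hy
  -- the floor-site values and the frame
  have hvy := floorSite_value hAF ⟨hr, hcarx, hevx, helim⟩ hx hSup hns hcont hconv hr hcarx hpin hbd helim hyU hyim
    hyr one_pos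
  have hv₁ := floorSite_value hAF ⟨hr, hcarx, hevx, helim⟩ hx hSup hns hcont hconv hr hcarx hpin hbd helim hz₁U
    hz₁im hz₁r one_pos
  have hv₂ := floorSite_value hAF ⟨hr, hcarx, hevx, helim⟩ hx hSup hns hcont hconv hr hcarx hpin hbd helim hz₂U
    hz₂im hz₂r one_pos
  set εf : ℝ := min η κ₁ / 4 with hεf
  have hminf : 0 < min η κ₁ := lt_min hη0 hκ₁0
  have hεf0 : 0 < εf := by positivity
  have hεfη : 4 * εf ≤ η := by have := min_le_left η κ₁; rw [hεf]; linarith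
  have hεfκ : 4 * εf ≤ κ₁ := by have := min_le_right η κ₁; rw [hεf]; linarith
  have hnear := rootFrame_near ⟨hr, hcarx, hevx, helim⟩ (hAF.2.2.1.mono fun _ h => h.2.2.2.1) hεf0
  have hW := flat_window (R' := 3 * r / 4) (by linarith) hpin hbd helim
  have hδev : ∀ᶠ δ : ℝ in 𝓝[>] 0, δ ∈ Set.Ioo 0 (min εf (r / 16)) := Ioo_mem_nhdsGT (lt_min hεf0 (by positivity))
  obtain ⟨n, ⟨ka, kb, j, γb, he, hb, _, _, hUb, hBb, hneb, _⟩, hvyn, hv₁n, hv₂n, ⟨hne, _, _⟩, hWn, ⟨hδ0, hδlt⟩,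
    hsc, hbdn, hpinn, hmassn⟩ :=
    ((hns.eventually (eventually_rootGateFrame hAF ⟨hr, hcarx, hevx, helim⟩ hx)).and (hvy.and (hv₁.and (hv₂.and
      ((hns.eventually hnear).and ((hns.eventually hW).and ((hns.eventually hδev).and
        ((hns.eventually (hAF.2.2.1.mono fun _ h => h.1)).and ((hns.eventually hbd).and
          ((hns.eventually hpin).and (hns.eventually hmass))))))))))).exists
  have hδεf : ns n < εf := lt_of_lt_of_le hδlt (min_le_left _ _)
  have hδr : ns n < r / 16 := lt_of_lt_of_le hδlt (min_le_right _ _)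
  obtain ⟨H, hH⟩ := potentialExists_proof (Λ (ns n)) hsc (e (ns n)) hbdn
  have hb' : b (ns n) = s(belowFace kb (m (ns n)), upFace kb (m (ns n))) := hb
  obtain ⟨-, -, hvay⟩ := hvyn H hH _ _ hb' _ (floorSite_mem_belowFace kb (m (ns n))) (floorSite_mem_upFace kb (m (ns n)))
  obtain ⟨-, -, hva₁⟩ := hv₁n H hH _ _ hb' _ (floorSite_mem_belowFace kb (m (ns n))) (floorSite_mem_upFace kb (m (ns n)))
  obtain ⟨-, -, hva₂⟩ := hv₂n H hH _ _ hb' _ (floorSite_mem_belowFace kb (m (ns n))) (floorSite_mem_upFace kb (m (ns n)))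
  obtain ⟨hineq, hηκ⟩ := divergence_at hsc hδ0 hδr hη0 hηr hκ₁0 (by linarith) (by linarith) (by linarith)
    (by linarith) he hb hUb hBb hneb γb hne hWn hpinn hH hyre hz₁re hz₂re hmassn hvay hva₁ hva₂
  rw [hA'val] at hineq hηκ
  have hηκ' : η < κ₁ + ns n := hηκ (by linarith [norm_nonneg (h z₁), abs_nonneg A])
  have hyA : |A| + 2 ≤ ‖h y‖ := by linarith
  -- a carrier point above `y`
  obtain ⟨τ, hτ, hτc⟩ := Metric.continuousWithinAt_iff.1 (hcont y hyU) 1 one_pos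
  set τ' : ℝ := min τ κ₁ / 2 with hτ'
  have hminτ : 0 < min τ κ₁ := lt_min hτ hκ₁0
  have hτ'0 : 0 < τ' := by positivity
  have hτ'τ : τ' < τ := by have := min_le_left τ κ₁; rw [hτ']; linarith
  have hτ'κ : 2 * τ' ≤ κ₁ := by have := min_le_right τ κ₁; rw [hτ']; linarith
  set z : ℂ := y + ((τ' : ℝ) : ℂ) * Complex.I with hz
  have hzy : ‖z - y‖ = τ' := by
    rw [hz, add_sub_cancel_left, norm_mul, Complex.norm_I, mul_one, Complex.norm_real, Real.norm_of_nonneg hτ'0.le]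
  have hzx2 : ‖z - x‖ < 2 * κ₁ := by
    calc ‖z - x‖ ≤ ‖z - y‖ + ‖y - x‖ := norm_sub_le_norm_sub_add_norm_sub _ _ _
      _ = τ' + η := by
          rw [hzy, hy, add_sub_cancel_left, Complex.norm_real, Real.norm_of_nonneg hη0.le]
      _ < 2 * κ₁ := by linarith
  have hzx : ‖z - x‖ < κ := by linarith
  have hzcar : z ∈ D.carrier := by
    have h1 : z ∈ {w : ℂ | x.im < w.im} ∩ Metric.ball x r := by
      refine ⟨?_, ?_⟩
      · show x.im < z.im
        rw [hz]; simp [hyim]; exact hτ'0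
      · rw [Metric.mem_ball, dist_eq_norm]; linarith
    rw [← hcarx] at h1
    exact h1.1
  have hzU : z ∈ (D.carrier ∪ (({z : ℂ | z.im = (D.pt 1).im} ∩ Metric.ball (D.pt 1) ρ) ∪
      ({z : ℂ | z.im = x.im} ∩ Metric.ball x r))) \ {x} := by
    refine ⟨Or.inl hzcar, fun h0 => ?_⟩
    have hxcar : x ∈ D.carrier := by rw [show z = x from h0] at hzcar; exact hzcar
    have : x ∈ D.carrier ∩ Metric.ball x r := ⟨hxcar, Metric.mem_ball_self hr⟩
    rw [hcarx] at this
    exact lt_irrefl _ (show x.im < x.im from this.1)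
  have hhz : dist (h z) (h y) < 1 := hτc hzU (by rw [dist_eq_norm, hzy]; exact hτ'τ)
  rw [dist_eq_norm] at hhz
  refine ⟨z, ⟨by rwa [Metric.mem_ball, dist_eq_norm], hzcar⟩, ?_⟩
  have := norm_sub_norm_le (h y) (h z)
  rw [norm_sub_rev] at hhz
  linarith [le_abs_self A]

end Frame

end Summit.CriticalPhenomena.SAWScalingLimit.Theorems.PickHalfPlane.BoundaryDataTransfer

end
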